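import Mathlib
import Summits.Ventures.PercRepro.TriangleCapTwoTrianglesEightE

/-!
# PercRepro — FOUR BELOW THE DIAGONAL, TWO TRIANGLES SHARING A VERTEX, EVERY `k ≥ 11` (p3, gen 39; part 123)

Gen 38's module TriangleCapThreeBelowTwoTrianglesB re-assembled at `r = 4`: the count of TriangleCapTwoTrianglesEightD
on `S = T₁ ∪ T₂` (two triangles sharing the vertex `t`, `|S| = 5`, `Q = 12`), with `H` the vertices hanging on `t`
(independent, `s = 1`) and `R′` the rest (`s ≤ 2`): `Σ deficit ≥ 8 + 4|H| + 8|R′| + 4 e(H, R′) + 2 e(R′)`, and the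
density `2m = 12 + 2 Σ s + Σ d ≤ 12 + 2|H| + 4|R′| + 2 e(H, R′) + 2 e(R′)` with `2m ≥ 6k − 26` gives
`2 e(H, R′) + 2 e(R′) ≥ 4|H| + 2|R′| − 8`; with every degree `≥ 2` every hanging vertex has a neighbour in `R′`
(`e(H, R′) ≥ |H|`), so `4 e(H, R′) + 2 e(R′) ≥ 6|H| + 2|R′| − 8 ≥ 4|H| + 4` as soon as `|H| + |R′| ≥ 6`, i.e.
`k ≥ 11`, and `Σ deficit ≥ 8k − 28` (**`eight_mul_card_le_sum_deficit_add_twentyeight_of_shared`**; at `k = 10` the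
count is short by `2` on the configuration `e(H, R′) = |H|`, `e(R′) = 1`, every `R′` vertex with two neighbours in
`S` — where the true gap is `32 ≥ 20`).  With `|T₃| ≤ 12` (`card_triangles3_le_twelve_of_shared`):
**`two_triangles_stability_four_of_shared`**: `K₄⁻`-free, `k ≥ 11`, `2m ≥ 6k − 26`, every degree `≥ 2`, two
triangles sharing a vertex and carrying every triangle ⇒ `Σ_v d(v)² + 4 (k − 5) ≤ m k`.  Numbers
(mining/p3/g39/tri4b.c): the minimum of `mk − Σ d² − 4(k − 5)` over the graphs whose triangles are exactly two sharing
a vertex, `m ≥ 3k − 13`, is `8` at `k = 10` and `14` at `k = 11`.  Axioms: standard.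
-/

namespace PercRepro

namespace TriangleCap

namespace C047

open Finset

variable {V : Type*} [Fintype V] [DecidableEq V]

/-- **THE FAR COUNT FOR TWO TRIANGLES SHARING A VERTEX AT `r = 4`:** `8k ≤ Σ_p deficit(p) + 28` for `k ≥ 11`,
`2m ≥ 6k − 26` and every degree `≥ 2`. -/
theorem eight_mul_card_le_sum_deficit_add_twentyeight_of_shared (D : SimpleGraph V) [DecidableRel D.Adj] (T₁ T₂ : Finset V)
    (h₁ : T₁.card = 3) (h₂ : T₂.card = 3) {t : V} (hint : T₁ ∩ T₂ = {t})
    (hcl₁ : ∀ x ∈ T₁, ∀ y ∈ T₁, x ≠ y → D.Adj x y) (hcl₂ : ∀ x ∈ T₂, ∀ y ∈ T₂, x ≠ y → D.Adj x y)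
    (hone₁ : ∀ z, z ∉ T₁ → degIn D T₁ z ≤ 1) (hone₂ : ∀ z, z ∉ T₂ → degIn D T₂ z ≤ 1)
    (hT : ∀ x y z, D.Adj x y → D.Adj x z → D.Adj y z → x ∈ T₁ ∪ T₂)
    (hk : 11 ≤ Fintype.card V) (hm : 6 * Fintype.card V ≤ 2 * D.edgeFinset.card + 26) (hdeg : ∀ z, 2 ≤ deg D z) :
    8 * Fintype.card V ≤ ∑ p ∈ adjPairsAll D, deficit D p + 28 := by
  have hint1 : (T₁ ∩ T₂).card ≤ 1 := by rw [hint, card_singleton]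
  have hcount := two_triangles_far_count D T₁ T₂ h₁ h₂ hint1 hcl₁ hcl₂
  have ht1 : t ∈ T₁ := (mem_inter.mp (by rw [hint]; exact mem_singleton_self t)).1
  have ht2 : t ∈ T₂ := (mem_inter.mp (by rw [hint]; exact mem_singleton_self t)).2
  set S := T₁ ∪ T₂ with hS
  have hScard : S.card = 5 := by
    have := card_union_add_card_inter T₁ T₂
    rw [hint, card_singleton, h₁, h₂] at this
    rw [hS]; omega
  have htS : t ∈ S := mem_union_left _ ht1
  -- the degrees into `S`
  have hcr_t_le : degIn D S t ≤ 4 := by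
    have := degIn_le_card_sub_one D htS
    rw [hScard] at this
    exact this
  have hcr_t_ge : 4 ≤ degIn D S t := by
    -- `T₁.erase t ∪ T₂.erase t ⊆ N(t) ∩ S`, disjoint, of cards `2 + 2`
    have hsub : (T₁.erase t ∪ T₂.erase t) ⊆ S.filter (fun y => D.Adj t y) := by
      intro y hy
      rw [mem_union, mem_erase, mem_erase] at hy
      rw [mem_filter]
      rcases hy with ⟨hyt, hy⟩ | ⟨hyt, hy⟩
      · exact ⟨mem_union_left _ hy, hcl₁ t ht1 y hy (Ne.symm hyt)⟩
      · exact ⟨mem_union_right _ hy, hcl₂ t ht2 y hy (Ne.symm hyt)⟩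
    have hdisj : Disjoint (T₁.erase t) (T₂.erase t) := by
      rw [disjoint_left]
      intro y hy1 hy2
      rw [mem_erase] at hy1 hy2
      have : y ∈ T₁ ∩ T₂ := mem_inter.mpr ⟨hy1.2, hy2.2⟩
      rw [hint, mem_singleton] at this
      exact hy1.1 this
    have := card_le_card hsub
    rw [card_union_of_disjoint hdisj, card_erase_of_mem ht1, card_erase_of_mem ht2, h₁, h₂] at this
    exact this
  -- on `S ∖ {t}`: exactly two neighbours in `S`
  have hside : ∀ x ∈ S, x ≠ t → (x ∈ T₁ ∧ x ∉ T₂) ∨ (x ∈ T₂ ∧ x ∉ T₁) := by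
    intro x hx hxt
    rw [hS, mem_union] at hx
    have hnot : ¬ (x ∈ T₁ ∧ x ∈ T₂) := fun h => by
      have : x ∈ T₁ ∩ T₂ := mem_inter.mpr h
      rw [hint, mem_singleton] at this
      exact hxt this
    rcases hx with hx | hx
    · exact Or.inl ⟨hx, fun h => hnot ⟨hx, h⟩⟩
    · exact Or.inr ⟨hx, fun h => hnot ⟨h, hx⟩⟩
  have hcr_le : ∀ x ∈ S, x ≠ t → degIn D S x ≤ 2 := by
    intro x hx hxt
    rcases hside x hx hxt with ⟨hx1, hx2⟩ | ⟨hx2, hx1⟩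
    · -- `N(x) ∩ T₂ = {t} ⊆ N(x) ∩ T₁`
      have hsub : S.filter (fun y => D.Adj x y) ⊆ T₁.filter (fun y => D.Adj x y) := by
        intro y hy
        rw [mem_filter] at hy
        rw [mem_filter]
        refine ⟨?_, hy.2⟩
        rw [hS, mem_union] at hy
        rcases hy.1 with h | h
        · exact h
        · have hone := hone₂ x hx2
          unfold degIn at hone
          have := card_le_one.mp hone y (mem_filter.mpr ⟨h, hy.2⟩) t
            (mem_filter.mpr ⟨ht2, hcl₁ x hx1 t ht1 hxt⟩)
          rw [this]; exact ht1
      have := card_le_card hsub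
      have h2 := degIn_le_two_of_mem D h₁ hx1
      unfold degIn at h2 ⊢
      omega
    · have hsub : S.filter (fun y => D.Adj x y) ⊆ T₂.filter (fun y => D.Adj x y) := by
        intro y hy
        rw [mem_filter] at hy
        rw [mem_filter]
        refine ⟨?_, hy.2⟩
        rw [hS, mem_union] at hy
        rcases hy.1 with h | h
        · have hone := hone₁ x hx1
          unfold degIn at hone
          have := card_le_one.mp hone y (mem_filter.mpr ⟨h, hy.2⟩) t
            (mem_filter.mpr ⟨ht1, hcl₂ x hx2 t ht2 hxt⟩)
          rw [this]; exact ht2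
        · exact h
      have := card_le_card hsub
      have h2 := degIn_le_two_of_mem D h₂ hx2
      unfold degIn at h2 ⊢
      omega
  have hcr_ge : ∀ x ∈ S, 2 ≤ degIn D S x := by
    intro x hx
    rw [hS] at hx ⊢
    rw [mem_union] at hx
    rcases hx with hx | hx
    · have := degIn_left_le_union D T₁ T₂ x
      rw [degIn_self_of_clique D h₁ hcl₁ hx] at this
      exact this
    · have := degIn_right_le_union D T₁ T₂ x
      rw [degIn_self_of_clique D h₂ hcl₂ hx] at this
      exact this
  -- `Q = 12`, `Σ_{T₁} + Σ_{T₂} ≤ 16`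
  have hsumS : ∀ (f : V → ℕ), ∑ x ∈ S, f x = f t + ∑ x ∈ S.erase t, f x := fun f =>
    (add_sum_erase S f htS).symm
  have hQ12 : adjPairs D S = 12 := by
    rw [adjPairs_eq_sum_degIn, hsumS]
    have hle : ∑ x ∈ S.erase t, degIn D S x ≤ ∑ _x ∈ S.erase t, 2 :=
      sum_le_sum (fun x hx => hcr_le x (mem_of_mem_erase hx) (ne_of_mem_erase hx))
    have hge : ∑ _x ∈ S.erase t, 2 ≤ ∑ x ∈ S.erase t, degIn D S x :=
      sum_le_sum (fun x hx => hcr_ge x (mem_of_mem_erase hx))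
    rw [sum_const, card_erase_of_mem htS, hScard, smul_eq_mul] at hle hge
    omega
  have hA : ∑ x ∈ T₁, degIn D S x + ∑ x ∈ T₂, degIn D S x ≤ 16 := by
    have e1 : ∑ x ∈ T₁, degIn D S x = degIn D S t + ∑ x ∈ T₁.erase t, degIn D S x :=
      (add_sum_erase T₁ _ ht1).symm
    have e2 : ∑ x ∈ T₂, degIn D S x = degIn D S t + ∑ x ∈ T₂.erase t, degIn D S x :=
      (add_sum_erase T₂ _ ht2).symm
    have l1 : ∑ x ∈ T₁.erase t, degIn D S x ≤ ∑ _x ∈ T₁.erase t, 2 :=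
      sum_le_sum (fun x hx => hcr_le x (mem_union_left _ (mem_of_mem_erase hx)) (ne_of_mem_erase hx))
    have l2 : ∑ x ∈ T₂.erase t, degIn D S x ≤ ∑ _x ∈ T₂.erase t, 2 :=
      sum_le_sum (fun x hx => hcr_le x (mem_union_right _ (mem_of_mem_erase hx)) (ne_of_mem_erase hx))
    rw [sum_const, card_erase_of_mem ht1, h₁, smul_eq_mul] at l1
    rw [sum_const, card_erase_of_mem ht2, h₂, smul_eq_mul] at l2
    omega
  -- off `S`: `degIn S z ≤ 2`, and `= 1` on the hanging vertices
  have hout : ∀ z ∈ Sᶜ, degIn D S z ≤ 2 := by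
    intro z hz
    rw [mem_compl, hS, mem_union, not_or] at hz
    rw [hS]
    have h := degIn_union_le D T₁ T₂ z
    have := hone₁ z hz.1
    have := hone₂ z hz.2
    omega
  have hhang : ∀ z ∈ Sᶜ, D.Adj z t → degIn D S z = 1 := by
    intro z hz hzt
    rw [mem_compl, hS, mem_union, not_or] at hz
    have hge : 1 ≤ degIn D S z := by
      unfold degIn
      apply card_pos.mpr
      exact ⟨t, mem_filter.mpr ⟨htS, hzt⟩⟩
    have hle : degIn D S z ≤ 1 := by
      unfold degIn
      apply card_le_one.mpr
      intro p hp q hq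
      rw [mem_filter] at hp hq
      -- every neighbour of `z` in `S` is `t`
      have key : ∀ p ∈ S, D.Adj z p → p = t := by
        intro p hp hzp
        rw [hS, mem_union] at hp
        rcases hp with hp | hp
        · have h := hone₁ z hz.1
          unfold degIn at h
          exact card_le_one.mp h p (mem_filter.mpr ⟨hp, hzp⟩) t (mem_filter.mpr ⟨ht1, hzt⟩)
        · have h := hone₂ z hz.2
          unfold degIn at h
          exact card_le_one.mp h p (mem_filter.mpr ⟨hp, hzp⟩) t (mem_filter.mpr ⟨ht2, hzt⟩)
      rw [key p hp.1 hp.2, key q hq.1 hq.2]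
    omega
  -- `W(z) ≤ 2 degIn S z + 2 [z ~ t]`
  have hW : ∀ z ∈ Sᶜ, ∑ x ∈ S.filter (fun x => D.Adj z x), degIn D S x ≤
      2 * degIn D S z + (if D.Adj z t then 2 else 0) := by
    intro z _
    have hpt : ∀ x ∈ S.filter (fun x => D.Adj z x), degIn D S x ≤ 2 + (if x = t then 2 else 0) := by
      intro x hx
      rw [mem_filter] at hx
      by_cases hxt : x = t
      · subst hxt; simp only [if_true]; omega
      · simp only [hxt, if_false, add_zero]; exact hcr_le x hx.1 hxt
    calc ∑ x ∈ S.filter (fun x => D.Adj z x), degIn D S x ≤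
        ∑ x ∈ S.filter (fun x => D.Adj z x), (2 + if x = t then 2 else 0) := sum_le_sum hpt
      _ = 2 * degIn D S z + (if D.Adj z t then 2 else 0) := by
        rw [sum_add_distrib, sum_const, smul_eq_mul, sum_ite_eq']
        unfold degIn
        simp only [mem_filter, htS, true_and]
        ring
  -- the hanging vertices `H` and the rest `R'`
  set H := Sᶜ.filter (fun z => D.Adj z t) with hH
  set R' := Sᶜ.filter (fun z => ¬ D.Adj z t) with hR'
  have hHR : H.card + R'.card = Sᶜ.card := card_filter_add_card_filter_not _
  have hRk : Sᶜ.card + 5 = Fintype.card V := by rw [card_compl, hScard]; omega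
  have hHind : ∀ z ∈ H, degIn D H z = 0 := by
    intro z hz
    rw [hH, mem_filter, mem_compl] at hz
    unfold degIn
    rw [card_eq_zero, filter_eq_empty_iff]
    intro z' hz' hzz'
    rw [hH, mem_filter, mem_compl] at hz'
    have := hT z z' t hzz' hz.2 hz'.2
    exact hz.1 this
  have hHdisj : Disjoint H R' := disjoint_filter_filter_not _ _ _
  have hHR' : H ∪ R' = Sᶜ := filter_union_filter_not_eq _ _
  -- the edge counts `e(H, R')` (both ways) and `E' = 2 e(R')`
  have heHR := sum_degIn_comm D H R'
  have hE' : ∑ y ∈ R', degIn D R' y ≤ R'.card * (R'.card - 1) := by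
    calc ∑ y ∈ R', degIn D R' y ≤ ∑ _y ∈ R', (R'.card - 1) :=
          sum_le_sum (fun y hy => degIn_le_card_sub_one D hy)
      _ = R'.card * (R'.card - 1) := by rw [sum_const, smul_eq_mul]
  have heHRle : ∑ z ∈ H, degIn D R' z ≤ H.card * R'.card := by
    calc ∑ z ∈ H, degIn D R' z ≤ ∑ _z ∈ H, R'.card := sum_le_sum (fun z _ => degIn_le_card D R' z)
      _ = H.card * R'.card := by rw [sum_const, smul_eq_mul]
  -- the outside sums split over `H` and `R'`
  have hsplit : ∀ (f : V → ℕ), ∑ z ∈ Sᶜ, f z = ∑ z ∈ H, f z + ∑ z ∈ R', f z := fun f =>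
    (sum_filter_add_sum_filter_not Sᶜ (fun z => D.Adj z t) f).symm
  have hdH : ∀ z ∈ H, degIn D Sᶜ z = degIn D R' z := by
    intro z hz
    rw [← hHR', degIn_union_of_disjoint D hHdisj z, hHind z hz, zero_add]
  have hdR : ∀ y ∈ R', degIn D Sᶜ y = degIn D H y + degIn D R' y := by
    intro y _
    rw [← hHR', degIn_union_of_disjoint D hHdisj y]
  have hsH : ∑ z ∈ H, degIn D S z = H.card := by
    rw [card_eq_sum_ones]
    apply sum_congr rfl
    intro z hz
    rw [hH, mem_filter] at hz
    exact hhang z hz.1 hz.2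
  have hsR : ∑ y ∈ R', degIn D S y ≤ 2 * R'.card := by
    calc ∑ y ∈ R', degIn D S y ≤ ∑ _y ∈ R', 2 :=
          sum_le_sum (fun y hy => hout y (mem_of_mem_filter y hy))
      _ = 2 * R'.card := by rw [sum_const, smul_eq_mul, mul_comm]
  have hdHsum : ∑ z ∈ H, degIn D Sᶜ z = ∑ z ∈ H, degIn D R' z := sum_congr rfl hdH
  have hdRsum : ∑ y ∈ R', degIn D Sᶜ y = ∑ y ∈ R', degIn D H y + ∑ y ∈ R', degIn D R' y := by
    rw [← sum_add_distrib]
    exact sum_congr rfl hdR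
  -- the density
  have hdens := two_mul_card_edges_eq_adjPairs_add D S
  rw [hQ12, hsplit (degIn D S), hsplit (degIn D Sᶜ)] at hdens
  -- the pointwise bound off `S`: `8 [z ~ t] + 2 s² + 2 s d + 4 + c(z) ≤ 12 + 2 s + 5 d`
  have hpt : ∀ z ∈ Sᶜ, (if D.Adj z t then 8 else 0) + 2 * (degIn D S z * degIn D S z) +
      2 * (degIn D S z * degIn D Sᶜ z) + 4 +
      (if D.Adj z t then 3 * degIn D Sᶜ z else 4 + degIn D Sᶜ z) ≤
      12 + 2 * degIn D S z + 5 * degIn D Sᶜ z := by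
    intro z hz
    by_cases hzt : D.Adj z t
    · rw [hhang z hz hzt]
      simp only [hzt, if_true]
      omega
    · simp only [hzt, if_false]
      have := hout z hz
      set s := degIn D S z with hs
      clear_value s
      interval_cases s <;> omega
  have hptsum := sum_le_sum hpt
  rw [sum_add_distrib, sum_add_distrib, sum_add_distrib, sum_add_distrib, sum_add_distrib,
    sum_add_distrib, ← mul_sum, ← mul_sum, ← mul_sum, ← mul_sum] at hptsum
  simp only [sum_const, smul_eq_mul] at hptsum
  have h8 : (∑ z ∈ Sᶜ, if D.Adj z t then 8 else 0) = 8 * H.card := by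
    rw [← sum_filter, sum_const, smul_eq_mul, mul_comm]
  have hc : (∑ z ∈ Sᶜ, if D.Adj z t then 3 * degIn D Sᶜ z else 4 + degIn D Sᶜ z) =
      3 * ∑ z ∈ H, degIn D Sᶜ z + (4 * R'.card + ∑ y ∈ R', degIn D Sᶜ y) := by
    rw [sum_ite, ← mul_sum, sum_add_distrib, sum_const, smul_eq_mul, ← hH, ← hR']
    ring
  rw [h8, hc] at hptsum
  have hWsum : ∑ z ∈ Sᶜ, ∑ x ∈ S.filter (fun x => D.Adj z x), degIn D S x ≤
      2 * ∑ z ∈ Sᶜ, degIn D S z + 2 * H.card := by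
    calc ∑ z ∈ Sᶜ, ∑ x ∈ S.filter (fun x => D.Adj z x), degIn D S x ≤
        ∑ z ∈ Sᶜ, (2 * degIn D S z + if D.Adj z t then 2 else 0) := sum_le_sum hW
      _ = 2 * ∑ z ∈ Sᶜ, degIn D S z + 2 * H.card := by
        rw [sum_add_distrib, ← mul_sum, ← sum_filter, sum_const, smul_eq_mul, mul_comm H.card]
  -- the far count with `Q = 12`, `|S| = 5`
  rw [hQ12, hScard] at hcount
  have hcsplit := hsplit (degIn D Sᶜ)
  have hssplit := hsplit (degIn D S)
  rw [hdHsum, hdRsum] at hptsum hcsplit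
  rw [hsH] at hssplit
  -- everything linear in the atoms except the two products
  have hk' : Fintype.card V = H.card + R'.card + 5 := by omega
  rw [hk'] at hm hk ⊢
  have hmain : 4 * H.card + 4 ≤ 4 * ∑ z ∈ H, degIn D R' z + ∑ y ∈ R', degIn D R' y →
      8 * (H.card + R'.card + 5) ≤ ∑ p ∈ adjPairsAll D, deficit D p + 28 := by
    intro h
    linarith
  apply hmain
  have hdensity : 4 * H.card + 2 * R'.card ≤ 2 * ∑ z ∈ H, degIn D R' z + ∑ y ∈ R', degIn D R' y + 8 := by
    linarith
  -- every hanging vertex has a neighbour in `R′` (its degree is `≥ 2`, its only neighbour in `S` is `t`)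
  have heH : H.card ≤ ∑ z ∈ H, degIn D R' z := by
    rw [card_eq_sum_ones]
    apply sum_le_sum
    intro z hz
    have h1 := hdeg z
    have h2 := deg_eq_degIn_add_degIn_compl D S z
    rw [hdH z hz] at h2
    have hz' := hz
    rw [hH, mem_filter] at hz'
    rw [hhang z hz'.1 hz'.2] at h2
    omega
  omega

/-- **FOUR BELOW THE DIAGONAL, TWO TRIANGLES SHARING A VERTEX, `k ≥ 11`:** `K₄⁻`-free, `2m ≥ 6k − 26`, every degree
`≥ 2`, every triangle on one of the two triangles `u v w`, `a b c` sharing the vertex `t` ⇒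
`Σ_v d(v)² + 4 (k − 5) ≤ m k`. -/
theorem two_triangles_stability_four_of_shared (D : SimpleGraph V) [DecidableRel D.Adj] (hK : K4mFree D)
    (hk : 11 ≤ Fintype.card V) (hm : 6 * Fintype.card V ≤ 2 * D.edgeFinset.card + 26) (hdeg : ∀ z, 2 ≤ deg D z)
    {u v w a b c : V}
    (huv : D.Adj u v) (huw : D.Adj u w) (hvw : D.Adj v w) (hab : D.Adj a b) (hac : D.Adj a c) (hbc : D.Adj b c)
    (ha : ¬ (a = u ∨ a = v ∨ a = w))
    (hT3 : ∀ x y z, D.Adj x y → D.Adj x z → D.Adj y z → x = u ∨ x = v ∨ x = w ∨ x = a ∨ x = b ∨ x = c)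
    {t : V} (ht : (t = u ∨ t = v ∨ t = w) ∧ (t = a ∨ t = b ∨ t = c)) :
    ∑ v, deg D v * deg D v + 4 * (Fintype.card V - 5) ≤ D.edgeFinset.card * Fintype.card V := by
  set T₁ : Finset V := {u, v, w} with hT₁
  set T₂ : Finset V := {a, b, c} with hT₂
  have h₁ : T₁.card = 3 := card_triple huv.ne huw.ne hvw.ne
  have h₂ : T₂.card = 3 := card_triple hab.ne hac.ne hbc.ne
  have hcl₁ := clique_triple D huv huw hvw
  have hcl₂ := clique_triple D hab hac hbc
  have hone₁ : ∀ z, z ∉ T₁ → degIn D T₁ z ≤ 1 := fun z hz => degIn_le_one_of_triangle D hK huv huw hvw hz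
  have hone₂ : ∀ z, z ∉ T₂ → degIn D T₂ z ≤ 1 := fun z hz => degIn_le_one_of_triangle D hK hab hac hbc hz
  have hT : ∀ x y z, D.Adj x y → D.Adj x z → D.Adj y z → x ∈ T₁ ∪ T₂ := by
    intro x y z hxy hxz hyz
    rw [hT₁, hT₂, mem_union]
    simp only [mem_insert, mem_singleton]
    rcases hT3 x y z hxy hxz hyz with h | h | h | h | h | h
    · exact Or.inl (Or.inl h)
    · exact Or.inl (Or.inr (Or.inl h))
    · exact Or.inl (Or.inr (Or.inr h))
    · exact Or.inr (Or.inl h)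
    · exact Or.inr (Or.inr (Or.inl h))
    · exact Or.inr (Or.inr (Or.inr h))
  have hint : T₁ ∩ T₂ = {t} := by
    ext x
    rw [mem_inter, mem_singleton, hT₁, hT₂]
    simp only [mem_insert, mem_singleton]
    constructor
    · intro hx
      exact shared_unique' D hK huv huw hvw hab hac hbc ha hx ht
    · rintro rfl
      exact ht
  have hdef := eight_mul_card_le_sum_deficit_add_twentyeight_of_shared D T₁ T₂ h₁ h₂ hint hcl₁ hcl₂ hone₁ hone₂ hT hk hm
    hdeg
  have h12 := card_triangles3_le_twelve_of_shared D T₁ T₂ h₁ h₂ hint hcl₁ hcl₂ hone₂ hT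
    (fun x y z z' hxy hxz hyz hxz' hyz' => eq_of_common_nbr D hK hxy hxz hyz hxz' hyz')
  have hid := two_mul_sum_deg_sq_add_sum_deficit D
  have hmk : 2 * (D.edgeFinset.card * Fintype.card V) = 2 * D.edgeFinset.card * Fintype.card V := by ring
  omega

end C047

end TriangleCap

end PercRepro
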